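import Summits.BirchSwinnertonDyer.BirchSwinnertonDyer.Theses.FrozenTwin

/-!
# Line `theta-augmentation` for crux `FrozenTwinBound` — route `FrozenTwin`, item stmt-BirchSwinnertonDyer-17173

Crux (fixed, the route's decl `Summit.BirchSwinnertonDyer.BirchSwinnertonDyer.Theses.FrozenTwin.FrozenTwinBound`): for
every admissible frozen-twin datum and every `k ≤ p - 2`, `p ∤ M_k := Σ_𝔞 C(dlog 𝔞, k)·φ(x_𝔞)` ⇒
`corank_(ℤ_p) Sel_(p^∞)(E/ℚ) ≤ k`.

THE CUT.  Line `birth` cuts the crux at the cardinality of `Sel_p(E/ℚ)` (freezing + Cassels–Tate–Flach doubling + an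
unprinted rank-0 `𝔓`-part bound for the order-`p` twin).  This ALTERNATIVE line cuts it at the ORDER OF VANISHING OF THE
CLASS-GROUP THETA ELEMENT in the group ring of the order-`p` quotient `C/pC ≅ ℤ/p` of `Cl_K` (`dlog mod p`):
`Θ̄_K := Σ_𝔞 φ(x_𝔞)·[dlog 𝔞 mod p] ∈ I^(s⁺)` in `ℤ_p[ℤ/p]`, `I` the augmentation ideal, `s⁺ = corank_(ℤ_p) Sel_(p^∞)(E/ℚ)`
(`stub_thetaAugOrder`) — the `n = 0`, `p ∣ h_K` layer of the Mazur–Tate–Darmon / Bertolini–Darmon order-of-vanishing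
statement (BD 1996 Conj. 4.1, inequality direction, in SELMER form and pushed to the `p`-quotient).  Below the cut is
algebra: `Θ̄_K ∈ I^n ⇒ S_χ = Σ ζ^(dlog 𝔞) φ(x_𝔞) ∈ 𝔓^n`, `𝔓 = (ζ - 1)` (`stub_augOrder_twistedSum`), and
`p ∤ M_k`, `k ≤ p - 2` ⇒ `S_χ ∉ 𝔓^(k+1)` (`stub_momentValuation`, shared verbatim with `birth`); hence `s⁺ ≤ k`.

WHY THE CUT HAS TEETH (the technique = Λ-ADIC TRANSFER from the solved sibling "order of vanishing of the
anticyclotomic `p`-adic `L`-function ≥ twice the max of the Selmer coranks", Bertolini–Darmon 2005 Cor. 3).  On TAME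
data — `7 ≤ p`, (PO) `a_p² ≢ 1 (mod p)`, CAPTURED class-group character (the order-`p` character `𝔞 ↦ ζ^(dlog 𝔞)`
kills the torsion `Δ` of `G̃_∞ = lim Pic(𝒪_(p^n))`, BD05 §1.2, i.e. is an unramified character of `Γ = Gal(K_∞^ac/K)`;
criterion: `𝔟 ∈ σ` prime to `p`, `𝔟^(p^m) = (t)` ⇒ `p^(m+1) ∤ t^(p²-1) - t̄^(p²-1)`) — the stub is PRINTED:
1. `C := char_Λ Sel_(p^∞)(E/K_∞)^∨ ∣ θ_∞²` in `Λ = ℤ_p⟦Γ⟧` (IMC, Euler-system direction: BD05 Thm 1; Pollack–Weston 2011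
   Thm 4.1 — squarefree `N`, `p ≥ 5`, (CR); Chida–Hsieh 2015 Thm 6.14 — any `N`, `p ≥ 7`, (CR⁺), (PO)); the crux side
   conditions (`p ∤ q² - 1` for `q ∣ N`, `ρ̄` surjective) make (CR)/(CR⁺) hold vacuously;
2. `C ∈ J^(2·max(s⁺,s⁻))`, `J = (γ - 1)`, `s⁻ = corank Sel_(p^∞)(E^K/ℚ)` (derived `p`-adic heights: BD 1995 Thm 2.23
   `ord char X_∞ ≥ ρ_p = Σ_k rank S̄^(k)` on the pro-`p` Selmer group `S_p(E/K)`, + Lemma 3.1: anti-equivariance makes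
   the null-space of `⟨⟨,⟩⟩₁` of rank `≥ |s⁺ - s⁻|`; standing assumptions (1) `p ∤ 2·#Φ(E/𝒪_K)` ⇐ `p ∤ v_q(j)`, `p ≥ 5`,
   (3) ⇐ `ρ̄` surjective, (4) ⇐ (PO) + ordinary by Prop. 1.1);
3. `𝒪⟦T⟧` is a domain, so `T^(2m) ∣ uθ²` ⇒ `T^m ∣ θ_∞`, `m = max(s⁺,s⁻)`;
4. the image of `θ_∞` in `ℤ_p[Γ/pΓ]` lies in `I^m`; captured ⇒ `Γ/pΓ = C/pC`, and that image is the level-0 element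
   `θ̃₀ = e_p ⋆ Θ_K` (BD 1996 §2.5 (8), §2.10 (10): `e_p = (1 - α⁻¹[σ_𝔭])(1 - α⁻¹[σ_𝔭⁻¹])` split / `1 - α⁻²` inert), and
   under (PO) `e_p` is a UNIT of the local ring `ℤ_p[C/pC]`: `Θ̄_K ∈ I^m ⊆ I^(s⁺)`.
On WILD data (anomalous `p`, `p = 5`, torsion `K`) the stub is NOT in print: `e_p ∈ 𝔪²` for anomalous `p` (and Ihara's
lemma needs (PO), CH15 p. 4), and for torsion `K` the value `χ(θ̃_∞)` lies on the `χ|_Δ`-BRANCH of `ℤ_p⟦G̃_∞⟧`, whose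
IMC is unprinted and whose bottom-layer control is the twin's Selmer group — there the stub is the level-0 BD96
Conj. 4.1 inequality in Selmer form, open (strategist census `Cruxes/FrozenTwinBound/STRATEGY-CENSUS.md`; the
tame/wild partition is filed as the split `FrozenTwinBound ⟸ FrozenTwinBoundTame ∧ FrozenTwinBoundWild`).

`FrozenTwinBound_of_stubs` composes the three statements (real proof: `L := CyclotomicField p ℚ`,
`ζ := (zeta_spec p ℚ L).toInteger`); `FrozenTwinBound_of : FrozenTwinBound` concludes the crux BY NAME.
`sorry` occurs ONLY in the three `stub_*` theorems (three sorries = three stubs); nowhere else.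
-/

namespace Summit.BirchSwinnertonDyer.BirchSwinnertonDyer.Cruxes.FrozenTwinBound.ThetaAugmentation

open scoped BigOperators

/-- STUB 1 (card P1, elementary; size M; SHARED verbatim with line `birth`). MOMENTS ⇒ VALUATION: for a prime `p`,
a finite index set `X`, exponents `d : X → ℕ`, weights `f : X → ℤ` and `k ≤ p - 2`: if `p ∤ M_k := Σ_x C(d x, k)·f x`
then for every primitive `p`-th root of unity `ζ` in the ring of integers of the `p`-th cyclotomic field
`S := Σ_x ζ^(d x)·f x ∉ (ζ - 1)^(k+1)` (`S = Σ_j (ζ-1)^j M_j`, `v_𝔓(ζ-1) = 1`, `v_𝔓(p) = p - 1 > k`;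
Washington, Cyclotomic Fields, Lemma 1.4). -/
theorem stub_momentValuation :
    ∀ (p : ℕ) [Fact p.Prime] (X : Type) [Fintype X] (d : X → ℕ) (f : X → ℤ) (k : ℕ), k + 2 ≤ p → ¬ (p : ℤ) ∣ ∑ x : X, ((d x).choose k : ℤ) * f x → ∀ (L : Type) [Field L] [CharZero L] [IsCyclotomicExtension {p} ℚ L] (ζ : NumberField.RingOfIntegers L), IsPrimitiveRoot ζ p → (∑ x : X, ζ ^ (d x) * ((f x : ℤ) : NumberField.RingOfIntegers L)) ∉ (Ideal.span {ζ - 1} : Ideal (NumberField.RingOfIntegers L)) ^ (k + 1) := by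
  sorry

/-- STUB 2 (the LOAD-BEARING leaf; size XL as a formal debt; PRINTED on tame data, OPEN on wild data).
THETA AUGMENTATION ORDER: for every admissible frozen-twin datum (the crux hypotheses verbatim), the class-group theta
element pushed to the order-`p` quotient, `Θ̄_K := Σ_𝔞 φ(x_𝔞)·[dlog 𝔞 mod p] ∈ ℤ_p[ℤ/p]`, lies in the `s⁺`-th power of
the augmentation ideal `I = ker(ℤ_p[ℤ/p] → ℤ_p, [g] ↦ 1)`, `s⁺ = corank_(ℤ_p) Sel_(p^∞)(E/ℚ)` — the `n = 0`, `p ∣ h_K`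
layer of BD 1996 Conj. 4.1 (inequality `ord ≥ max(r̃⁺,r̃⁻)`), in Selmer form.  Why plausibly true: on TAME data it is
BD05 Cor. 3 specialised (steps 1–4 of the module docstring); in general it is equivalent (given `M_0 = 0` when `s⁺ ≥ 1`,
Kato + Gross–Zhang, and the algebra `aug x = 0 ∧ χ(x) ∈ 𝔓^n ⇒ x ∈ I^n`) to `v_𝔓(S_χ) ≥ s⁺`, which the route's
FT-review derived from rank-0 BSD for the twin + doubling, and which kit j023370 tested (767 rows, 0 violations).
Why it might fail: on wild data nothing printed bounds it (anomalous `e_p`, torsion branch); on tame data only a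
Selmer-convention slip in reading Cor. 3 (classical = minimal Selmer over `K_∞` under the side conditions). -/
theorem stub_thetaAugOrder :
    ∀ (V : WeierstrassCurve ℚ) [V.IsElliptic] [V.IsGloballyMinimal] (p : ℕ) [Fact p.Prime] (Nplus Nminus m : ℕ) (a b : ℚ) (O : Subring (QuaternionAlgebra ℚ a 0 b)) (K : Type) [Field K] [NumberField K] (ψ : K →ₐ[ℚ] QuaternionAlgebra ℚ a 0 b) (I : Submodule ℤ (QuaternionAlgebra ℚ a 0 b)) (φ : Submodule ℤ (QuaternionAlgebra ℚ a 0 b) → ℤ) (rep : ClassGroup (NumberField.RingOfIntegers K) → nonZeroDivisors (Ideal (NumberField.RingOfIntegers K))) (RI : Set (Submodule ℤ (QuaternionAlgebra ℚ a 0 b))) (σ : ClassGroup (NumberField.RingOfIntegers K)) (dlog : ClassGroup (NumberField.RingOfIntegers K) → ℕ), ((5 ≤ p ∧ V.HasGoodReductionAtPrime p ∧ ¬ (p : ℤ) ∣ V.frobeniusTrace p ∧ V.HasSurjectiveModNGaloisRep p ∧ (∀ q : ℕ, q.Prime → q ∣ V.conductorNorm ℤ → ¬ (p : ℤ) ∣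 (q : ℤ) ^ 2 - 1) ∧ (∀ (q : ℕ) (_ : Fact q.Prime), V.HasMultiplicativeReductionAtPrime q → ¬ (p : ℤ) ∣ padicValRat q V.j)) ∧ (Module.finrank ℚ K = 2 ∧ NumberField.IsTotallyComplex K ∧ NumberField.discr K < -4 ∧ Int.gcd (NumberField.discr K) (V.conductorNorm ℤ * p) = 1) ∧ (V.conductorNorm ℤ = Nplus * Nminus ∧ Nat.Coprime Nplus Nminus ∧ Squarefree Nminus ∧ Odd Nminus.primeFactors.card ∧ (∀ q : ℕ, q.Prime → q ∣ Nplus → ((Ideal.span {(q : ℤ)}).primesOver (NumberField.RingOfIntegers K)).ncard = 2) ∧ (∀ q : ℕ, q.Prime → q ∣ Nminus → ((Ideal.span {(q : ℤ)}).primesOver (NumberField.RingOfIntegers K)).ncard = 1)) ∧ (a < 0 ∧ b < 0 ∧ (∀ (q : ℕ) [Fact q.Prime], (∀ x : QuaternionAlgebra ℚ_[q] (a : ℚ_[q]) 0 (b : ℚ_[q]), x ≠ 0 → IsUnit x) ↔ q ∣ Nminus)) ∧ (∃ O₁ O₂ : Subring (QuaternionAlgebra ℚ a 0 b), (∀ S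 : Subring (QuaternionAlgebra ℚ a 0 b), (S = O₁ ∨ S = O₂) → (S.toAddSubgroup.FG ∧ (∀ d : QuaternionAlgebra ℚ a 0 b, ∃ n : ℤ, n ≠ 0 ∧ n • d ∈ S) ∧ ∀ S' : Subring (QuaternionAlgebra ℚ a 0 b), S'.toAddSubgroup.FG → S ≤ S' → S' = S)) ∧ O = O₁ ⊓ O₂ ∧ O.toAddSubgroup.relIndex O₁.toAddSubgroup = Nplus) ∧ (∀ J : Submodule ℤ (QuaternionAlgebra ℚ a 0 b), J ∈ RI ↔ (J.FG ∧ (∀ d : QuaternionAlgebra ℚ a 0 b, ∃ n : ℤ, n ≠ 0 ∧ n • d ∈ J) ∧ (∀ x : QuaternionAlgebra ℚ a 0 b, (∀ y ∈ J, y * x ∈ J) ↔ x ∈ O) ∧ (∃ J' : Submodule ℤ (QuaternionAlgebra ℚ a 0 b), (∀ x : QuaternionAlgebra ℚ a 0 b, x ∈ J * J' ↔ ∀ y ∈ J, x * y ∈ J) ∧ (∀ x : QuaternionAlgebra ℚ a 0 b, x ∈ J' * J ↔ x ∈ O)))) ∧ ((∀ J ∈ RI, ∀ β : QuaternionAlgebra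 ℚ a 0 b, IsUnit β → φ (J.map (AddMonoidHom.mulLeft β).toIntLinearMap) = φ J) ∧ (∀ q : ℕ, q.Prime → ¬ q ∣ V.conductorNorm ℤ → ∀ J ∈ RI, ∑ᶠ J' ∈ {J' : Submodule ℤ (QuaternionAlgebra ℚ a 0 b) | J' ≤ J ∧ J'.toAddSubgroup.relIndex J.toAddSubgroup = q ^ 2 ∧ ∀ y ∈ J', ∀ x ∈ O, y * x ∈ J'}, φ J' = (V.frobeniusTrace q : ℤ) * φ J) ∧ (∃ J ∈ RI, ¬ (p : ℤ) ∣ φ J)) ∧ (I ∈ RI ∧ (∀ x : NumberField.RingOfIntegers K, ∀ y ∈ I, ψ (x : K) * y ∈ I) ∧ (∀ x : K, (∀ y ∈ I, ψ x * y ∈ I) → ∃ z : NumberField.RingOfIntegers K, (z : K) = x) ∧ (∀ 𝔞 : ClassGroup (NumberField.RingOfIntegers K), ClassGroup.mk0 (rep 𝔞) = 𝔞) ∧ (∀ 𝔞 : ClassGroup (NumberField.RingOfIntegers K), Submodule.span ℤ ((fun x : NumberField.RingOfIntegers K => ψ (x : K)) '' ((rep 𝔞 : nonZeroDivisors (Ideal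 (NumberField.RingOfIntegers K))) : Ideal (NumberField.RingOfIntegers K))) * I ∈ RI)) ∧ (1 ≤ m ∧ orderOf σ = p ^ m ∧ ¬ p ^ (m + 1) ∣ Fintype.card (ClassGroup (NumberField.RingOfIntegers K)) ∧ (∀ 𝔞 : ClassGroup (NumberField.RingOfIntegers K), dlog 𝔞 < p ^ m ∧ Nat.Coprime (orderOf (𝔞 * (σ ^ dlog 𝔞)⁻¹)) p))) → (∑ 𝔞 : ClassGroup (NumberField.RingOfIntegers K), MonoidAlgebra.single (Multiplicative.ofAdd ((dlog 𝔞 : ℕ) : ZMod p)) ((φ (Submodule.span ℤ ((fun x : NumberField.RingOfIntegers K => ψ (x : K)) '' ((rep 𝔞 : nonZeroDivisors (Ideal (NumberField.RingOfIntegers K))) : Ideal (NumberField.RingOfIntegers K))) * I) : ℤ) : ℤ_[p])) ∈ (RingHom.ker (MonoidAlgebra.lift ℤ_[p] ℤ_[p] (Multiplicative (ZMod p)) (1 : Multiplicative (ZMod p) →* ℤ_[p]))) ^ (V.selmerCorank p) := by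
  sorry

/-- STUB 3 (pure commutative algebra; size M; provable now). AUGMENTATION ORDER ⇒ TWISTED-SUM VALUATION: for a prime
`p`, a finite set `X`, `d : X → ℕ`, `f : X → ℤ`: if `Σ_x f(x)·[d x mod p] ∈ I^n` in `ℤ_p[ℤ/p]` (`I` the augmentation
ideal) then for every primitive `p`-th root of unity `ζ` in `𝓞(ℚ(ζ_p))`, `Σ_x ζ^(d x) f(x) ∈ (ζ - 1)^n`.  Proof sketch:
the character `[g] ↦ ζ^g` extends to `ℤ_p[ℤ/p] → 𝓞 ⊗ ℤ_p = 𝓞_𝔓` and maps `I` into `(ζ - 1)`; `𝔓 = (ζ - 1)` is the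
unique prime over `p`, so `(ζ-1)^n 𝓞_𝔓 ∩ 𝓞 = 𝔓^n` (equivalently: `∃ N`, `p ∤ N`, `N·Θ ∈ I^n_(ℤ[ℤ/p])`, then evaluate). -/
theorem stub_augOrder_twistedSum :
    ∀ (p : ℕ) [Fact p.Prime] (X : Type) [Fintype X] (d : X → ℕ) (f : X → ℤ) (n : ℕ), (∑ x : X, MonoidAlgebra.single (Multiplicative.ofAdd ((d x : ℕ) : ZMod p)) ((f x : ℤ) : ℤ_[p])) ∈ (RingHom.ker (MonoidAlgebra.lift ℤ_[p] ℤ_[p] (Multiplicative (ZMod p)) (1 : Multiplicative (ZMod p) →* ℤ_[p]))) ^ n → ∀ (L : Type) [Field L] [CharZero L] [IsCyclotomicExtension {p} ℚ L] (ζ : NumberField.RingOfIntegers L), IsPrimitiveRoot ζ p → (∑ x : X, ζ ^ (d x) * ((f x : ℤ) : NumberField.RingOfIntegers L)) ∈ (Ideal.span {ζ - 1} : Ideal (NumberField.RingOfIntegers L)) ^ n := by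
  sorry

/-! ## Assembly (sorry-free) -/

/-- ASSEMBLY (kernel-checked, real proof): the three stub STATEMENTS imply the crux statement (verbatim the body of
`FrozenTwin.FrozenTwinBound`; `FrozenTwinBound_of` below restates it BY NAME).  Given the datum and `p ∤ M_k`
(`k + 2 ≤ p`): stub 2 puts `Θ̄_K` in `I^(s⁺)`, stub 3 turns this into `S_χ ∈ 𝔓^(s⁺)` in `L := CyclotomicField p ℚ` at
Mathlib's `zeta`, stub 1 gives `S_χ ∉ 𝔓^(k+1)`; were `s⁺ ≥ k + 1`, `𝔓^(s⁺) ≤ 𝔓^(k+1)` — contradiction; so `s⁺ ≤ k`. -/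
theorem FrozenTwinBound_of_stubs
    (h1 : ∀ (p : ℕ) [Fact p.Prime] (X : Type) [Fintype X] (d : X → ℕ) (f : X → ℤ) (k : ℕ), k + 2 ≤ p → ¬ (p : ℤ) ∣ ∑ x : X, ((d x).choose k : ℤ) * f x → ∀ (L : Type) [Field L] [CharZero L] [IsCyclotomicExtension {p} ℚ L] (ζ : NumberField.RingOfIntegers L), IsPrimitiveRoot ζ p → (∑ x : X, ζ ^ (d x) * ((f x : ℤ) : NumberField.RingOfIntegers L)) ∉ (Ideal.span {ζ - 1} : Ideal (NumberField.RingOfIntegers L)) ^ (k + 1))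
    (h2 : ∀ (V : WeierstrassCurve ℚ) [V.IsElliptic] [V.IsGloballyMinimal] (p : ℕ) [Fact p.Prime] (Nplus Nminus m : ℕ) (a b : ℚ) (O : Subring (QuaternionAlgebra ℚ a 0 b)) (K : Type) [Field K] [NumberField K] (ψ : K →ₐ[ℚ] QuaternionAlgebra ℚ a 0 b) (I : Submodule ℤ (QuaternionAlgebra ℚ a 0 b)) (φ : Submodule ℤ (QuaternionAlgebra ℚ a 0 b) → ℤ) (rep : ClassGroup (NumberField.RingOfIntegers K) → nonZeroDivisors (Ideal (NumberField.RingOfIntegers K))) (RI : Set (Submodule ℤ (QuaternionAlgebra ℚ a 0 b))) (σ : ClassGroup (NumberField.RingOfIntegers K)) (dlog : ClassGroup (NumberField.RingOfIntegers K) → ℕ), ((5 ≤ p ∧ V.HasGoodReductionAtPrime p ∧ ¬ (p : ℤ) ∣ V.frobeniusTrace p ∧ V.HasSurjectiveModNGaloisRep p ∧ (∀ q : ℕ, q.Prime → q ∣ V.conductorNorm ℤ → ¬ (p : ℤ) ∣ (q : ℤ) ^ 2 - 1) ∧ (∀ (q : ℕ) (_ : Fact q.Prime), V.HasMultiplicativeReductionAtPrime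 q → ¬ (p : ℤ) ∣ padicValRat q V.j)) ∧ (Module.finrank ℚ K = 2 ∧ NumberField.IsTotallyComplex K ∧ NumberField.discr K < -4 ∧ Int.gcd (NumberField.discr K) (V.conductorNorm ℤ * p) = 1) ∧ (V.conductorNorm ℤ = Nplus * Nminus ∧ Nat.Coprime Nplus Nminus ∧ Squarefree Nminus ∧ Odd Nminus.primeFactors.card ∧ (∀ q : ℕ, q.Prime → q ∣ Nplus → ((Ideal.span {(q : ℤ)}).primesOver (NumberField.RingOfIntegers K)).ncard = 2) ∧ (∀ q : ℕ, q.Prime → q ∣ Nminus → ((Ideal.span {(q : ℤ)}).primesOver (NumberField.RingOfIntegers K)).ncard = 1)) ∧ (a < 0 ∧ b < 0 ∧ (∀ (q : ℕ) [Fact q.Prime], (∀ x : QuaternionAlgebra ℚ_[q] (a : ℚ_[q]) 0 (b : ℚ_[q]), x ≠ 0 → IsUnit x) ↔ q ∣ Nminus)) ∧ (∃ O₁ O₂ : Subring (QuaternionAlgebra ℚ a 0 b), (∀ S : Subring (QuaternionAlgebra ℚ a 0 b), (S = O₁ ∨ S = O₂) → (S.toAddSubgroup.FG ∧ (∀ d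 : QuaternionAlgebra ℚ a 0 b, ∃ n : ℤ, n ≠ 0 ∧ n • d ∈ S) ∧ ∀ S' : Subring (QuaternionAlgebra ℚ a 0 b), S'.toAddSubgroup.FG → S ≤ S' → S' = S)) ∧ O = O₁ ⊓ O₂ ∧ O.toAddSubgroup.relIndex O₁.toAddSubgroup = Nplus) ∧ (∀ J : Submodule ℤ (QuaternionAlgebra ℚ a 0 b), J ∈ RI ↔ (J.FG ∧ (∀ d : QuaternionAlgebra ℚ a 0 b, ∃ n : ℤ, n ≠ 0 ∧ n • d ∈ J) ∧ (∀ x : QuaternionAlgebra ℚ a 0 b, (∀ y ∈ J, y * x ∈ J) ↔ x ∈ O) ∧ (∃ J' : Submodule ℤ (QuaternionAlgebra ℚ a 0 b), (∀ x : QuaternionAlgebra ℚ a 0 b, x ∈ J * J' ↔ ∀ y ∈ J, x * y ∈ J) ∧ (∀ x : QuaternionAlgebra ℚ a 0 b, x ∈ J' * J ↔ x ∈ O)))) ∧ ((∀ J ∈ RI, ∀ β : QuaternionAlgebra ℚ a 0 b, IsUnit β → φ (J.map (AddMonoidHom.mulLeft β).toIntLinearMap) = φ J) ∧ (∀ q :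 ℕ, q.Prime → ¬ q ∣ V.conductorNorm ℤ → ∀ J ∈ RI, ∑ᶠ J' ∈ {J' : Submodule ℤ (QuaternionAlgebra ℚ a 0 b) | J' ≤ J ∧ J'.toAddSubgroup.relIndex J.toAddSubgroup = q ^ 2 ∧ ∀ y ∈ J', ∀ x ∈ O, y * x ∈ J'}, φ J' = (V.frobeniusTrace q : ℤ) * φ J) ∧ (∃ J ∈ RI, ¬ (p : ℤ) ∣ φ J)) ∧ (I ∈ RI ∧ (∀ x : NumberField.RingOfIntegers K, ∀ y ∈ I, ψ (x : K) * y ∈ I) ∧ (∀ x : K, (∀ y ∈ I, ψ x * y ∈ I) → ∃ z : NumberField.RingOfIntegers K, (z : K) = x) ∧ (∀ 𝔞 : ClassGroup (NumberField.RingOfIntegers K), ClassGroup.mk0 (rep 𝔞) = 𝔞) ∧ (∀ 𝔞 : ClassGroup (NumberField.RingOfIntegers K), Submodule.span ℤ ((fun x : NumberField.RingOfIntegers K => ψ (x : K)) '' ((rep 𝔞 : nonZeroDivisors (Ideal (NumberField.RingOfIntegers K))) : Ideal (NumberField.RingOfIntegers K))) * I ∈ RI)) ∧ (1 ≤ m ∧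 orderOf σ = p ^ m ∧ ¬ p ^ (m + 1) ∣ Fintype.card (ClassGroup (NumberField.RingOfIntegers K)) ∧ (∀ 𝔞 : ClassGroup (NumberField.RingOfIntegers K), dlog 𝔞 < p ^ m ∧ Nat.Coprime (orderOf (𝔞 * (σ ^ dlog 𝔞)⁻¹)) p))) → (∑ 𝔞 : ClassGroup (NumberField.RingOfIntegers K), MonoidAlgebra.single (Multiplicative.ofAdd ((dlog 𝔞 : ℕ) : ZMod p)) ((φ (Submodule.span ℤ ((fun x : NumberField.RingOfIntegers K => ψ (x : K)) '' ((rep 𝔞 : nonZeroDivisors (Ideal (NumberField.RingOfIntegers K))) : Ideal (NumberField.RingOfIntegers K))) * I) : ℤ) : ℤ_[p])) ∈ (RingHom.ker (MonoidAlgebra.lift ℤ_[p] ℤ_[p] (Multiplicative (ZMod p)) (1 : Multiplicative (ZMod p) →* ℤ_[p]))) ^ (V.selmerCorank p))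
    (h3 : ∀ (p : ℕ) [Fact p.Prime] (X : Type) [Fintype X] (d : X → ℕ) (f : X → ℤ) (n : ℕ), (∑ x : X, MonoidAlgebra.single (Multiplicative.ofAdd ((d x : ℕ) : ZMod p)) ((f x : ℤ) : ℤ_[p])) ∈ (RingHom.ker (MonoidAlgebra.lift ℤ_[p] ℤ_[p] (Multiplicative (ZMod p)) (1 : Multiplicative (ZMod p) →* ℤ_[p]))) ^ n → ∀ (L : Type) [Field L] [CharZero L] [IsCyclotomicExtension {p} ℚ L] (ζ : NumberField.RingOfIntegers L), IsPrimitiveRoot ζ p → (∑ x : X, ζ ^ (d x) * ((f x : ℤ) : NumberField.RingOfIntegers L)) ∈ (Ideal.span {ζ - 1} : Ideal (NumberField.RingOfIntegers L)) ^ n) :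
    ∀ (V : WeierstrassCurve ℚ) [V.IsElliptic] [V.IsGloballyMinimal] (p : ℕ) [Fact p.Prime] (Nplus Nminus m : ℕ) (a b : ℚ) (O : Subring (QuaternionAlgebra ℚ a 0 b)) (K : Type) [Field K] [NumberField K] (ψ : K →ₐ[ℚ] QuaternionAlgebra ℚ a 0 b) (I : Submodule ℤ (QuaternionAlgebra ℚ a 0 b)) (φ : Submodule ℤ (QuaternionAlgebra ℚ a 0 b) → ℤ) (rep : ClassGroup (NumberField.RingOfIntegers K) → nonZeroDivisors (Ideal (NumberField.RingOfIntegers K))) (RI : Set (Submodule ℤ (QuaternionAlgebra ℚ a 0 b))) (σ : ClassGroup (NumberField.RingOfIntegers K)) (dlog : ClassGroup (NumberField.RingOfIntegers K) → ℕ), ((5 ≤ p ∧ V.HasGoodReductionAtPrime p ∧ ¬ (p : ℤ) ∣ V.frobeniusTrace p ∧ V.HasSurjectiveModNGaloisRep p ∧ (∀ q : ℕ, q.Prime → q ∣ V.conductorNorm ℤ → ¬ (p : ℤ) ∣ (q : ℤ) ^ 2 - 1) ∧ (∀ (q : ℕ) (_ : Fact q.Prime), V.HasMultiplicativeReductionAtPrime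 q → ¬ (p : ℤ) ∣ padicValRat q V.j)) ∧ (Module.finrank ℚ K = 2 ∧ NumberField.IsTotallyComplex K ∧ NumberField.discr K < -4 ∧ Int.gcd (NumberField.discr K) (V.conductorNorm ℤ * p) = 1) ∧ (V.conductorNorm ℤ = Nplus * Nminus ∧ Nat.Coprime Nplus Nminus ∧ Squarefree Nminus ∧ Odd Nminus.primeFactors.card ∧ (∀ q : ℕ, q.Prime → q ∣ Nplus → ((Ideal.span {(q : ℤ)}).primesOver (NumberField.RingOfIntegers K)).ncard = 2) ∧ (∀ q : ℕ, q.Prime → q ∣ Nminus → ((Ideal.span {(q : ℤ)}).primesOver (NumberField.RingOfIntegers K)).ncard = 1)) ∧ (a < 0 ∧ b < 0 ∧ (∀ (q : ℕ) [Fact q.Prime], (∀ x : QuaternionAlgebra ℚ_[q] (a : ℚ_[q]) 0 (b : ℚ_[q]), x ≠ 0 → IsUnit x) ↔ q ∣ Nminus)) ∧ (∃ O₁ O₂ : Subring (QuaternionAlgebra ℚ a 0 b), (∀ S : Subring (QuaternionAlgebra ℚ a 0 b), (S = O₁ ∨ S = O₂) → (S.toAddSubgroup.FG ∧ (∀ d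 : QuaternionAlgebra ℚ a 0 b, ∃ n : ℤ, n ≠ 0 ∧ n • d ∈ S) ∧ ∀ S' : Subring (QuaternionAlgebra ℚ a 0 b), S'.toAddSubgroup.FG → S ≤ S' → S' = S)) ∧ O = O₁ ⊓ O₂ ∧ O.toAddSubgroup.relIndex O₁.toAddSubgroup = Nplus) ∧ (∀ J : Submodule ℤ (QuaternionAlgebra ℚ a 0 b), J ∈ RI ↔ (J.FG ∧ (∀ d : QuaternionAlgebra ℚ a 0 b, ∃ n : ℤ, n ≠ 0 ∧ n • d ∈ J) ∧ (∀ x : QuaternionAlgebra ℚ a 0 b, (∀ y ∈ J, y * x ∈ J) ↔ x ∈ O) ∧ (∃ J' : Submodule ℤ (QuaternionAlgebra ℚ a 0 b), (∀ x : QuaternionAlgebra ℚ a 0 b, x ∈ J * J' ↔ ∀ y ∈ J, x * y ∈ J) ∧ (∀ x : QuaternionAlgebra ℚ a 0 b, x ∈ J' * J ↔ x ∈ O)))) ∧ ((∀ J ∈ RI, ∀ β : QuaternionAlgebra ℚ a 0 b, IsUnit β → φ (J.map (AddMonoidHom.mulLeft β).toIntLinearMap) = φ J) ∧ (∀ q :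 ℕ, q.Prime → ¬ q ∣ V.conductorNorm ℤ → ∀ J ∈ RI, ∑ᶠ J' ∈ {J' : Submodule ℤ (QuaternionAlgebra ℚ a 0 b) | J' ≤ J ∧ J'.toAddSubgroup.relIndex J.toAddSubgroup = q ^ 2 ∧ ∀ y ∈ J', ∀ x ∈ O, y * x ∈ J'}, φ J' = (V.frobeniusTrace q : ℤ) * φ J) ∧ (∃ J ∈ RI, ¬ (p : ℤ) ∣ φ J)) ∧ (I ∈ RI ∧ (∀ x : NumberField.RingOfIntegers K, ∀ y ∈ I, ψ (x : K) * y ∈ I) ∧ (∀ x : K, (∀ y ∈ I, ψ x * y ∈ I) → ∃ z : NumberField.RingOfIntegers K, (z : K) = x) ∧ (∀ 𝔞 : ClassGroup (NumberField.RingOfIntegers K), ClassGroup.mk0 (rep 𝔞) = 𝔞) ∧ (∀ 𝔞 : ClassGroup (NumberField.RingOfIntegers K), Submodule.span ℤ ((fun x : NumberField.RingOfIntegers K => ψ (x : K)) '' ((rep 𝔞 : nonZeroDivisors (Ideal (NumberField.RingOfIntegers K))) : Ideal (NumberField.RingOfIntegers K))) * I ∈ RI)) ∧ (1 ≤ m ∧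 orderOf σ = p ^ m ∧ ¬ p ^ (m + 1) ∣ Fintype.card (ClassGroup (NumberField.RingOfIntegers K)) ∧ (∀ 𝔞 : ClassGroup (NumberField.RingOfIntegers K), dlog 𝔞 < p ^ m ∧ Nat.Coprime (orderOf (𝔞 * (σ ^ dlog 𝔞)⁻¹)) p))) → ∀ k : ℕ, k + 2 ≤ p → ¬ (p : ℤ) ∣ ∑ 𝔞 : ClassGroup (NumberField.RingOfIntegers K), ((dlog 𝔞).choose k : ℤ) * φ (Submodule.span ℤ ((fun x : NumberField.RingOfIntegers K => ψ (x : K)) '' ((rep 𝔞 : nonZeroDivisors (Ideal (NumberField.RingOfIntegers K))) : Ideal (NumberField.RingOfIntegers K))) * I) → V.selmerCorank p ≤ k := by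
  intro V _ _ p hp Nplus Nminus m a b O K _ _ ψ I φ rep RI σ dlog hH k hkp hndvd
  haveI : NeZero p := ⟨hp.out.ne_zero⟩
  haveI : IsCyclotomicExtension {p} ℚ (CyclotomicField p ℚ) :=
    CyclotomicField.isCyclotomicExtension p ℚ
  have hζ := (IsCyclotomicExtension.zeta_spec p ℚ (CyclotomicField p ℚ)).toInteger_isPrimitiveRoot
  -- stub 1: `S_χ ∉ 𝔓^(k+1)`
  have hval := h1 p (ClassGroup (NumberField.RingOfIntegers K)) dlog
    (fun 𝔞 => φ (Submodule.span ℤ ((fun x : NumberField.RingOfIntegers K => ψ (x : K)) '' ((rep 𝔞 : nonZeroDivisors (Ideal (NumberField.RingOfIntegers K))) : Ideal (NumberField.RingOfIntegers K))) * I)) k hkp hndvd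
    (CyclotomicField p ℚ) _ hζ
  -- stub 2: `Θ̄_K ∈ I^(s⁺)`; stub 3: `S_χ ∈ 𝔓^(s⁺)`
  have haug := h2 V p Nplus Nminus m a b O K ψ I φ rep RI σ dlog hH
  have hmem := h3 p (ClassGroup (NumberField.RingOfIntegers K)) dlog
    (fun 𝔞 => φ (Submodule.span ℤ ((fun x : NumberField.RingOfIntegers K => ψ (x : K)) '' ((rep 𝔞 : nonZeroDivisors (Ideal (NumberField.RingOfIntegers K))) : Ideal (NumberField.RingOfIntegers K))) * I)) (V.selmerCorank p) haug
    (CyclotomicField p ℚ) _ hζ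
  by_contra hlt
  exact hval (Ideal.pow_le_pow_right (Nat.succ_le_of_lt (not_le.mp hlt)) hmem)

/-- THE SKELETON THEOREM (registrar shape): the crux `FrozenTwin.FrozenTwinBound`, concluded BY NAME from the three
declared stubs through the sorry-free assembly `FrozenTwinBound_of_stubs`; the only `sorry`s in its closure are
`stub_momentValuation`, `stub_thetaAugOrder`, `stub_augOrder_twistedSum`. -/
theorem FrozenTwinBound_of :
    Summit.BirchSwinnertonDyer.BirchSwinnertonDyer.Theses.FrozenTwin.FrozenTwinBound :=
  FrozenTwinBound_of_stubs @stub_momentValuation @stub_thetaAugOrder @stub_augOrder_twistedSum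

end Summit.BirchSwinnertonDyer.BirchSwinnertonDyer.Cruxes.FrozenTwinBound.ThetaAugmentation
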